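import Literature.Geometry.Riemannian.PerelmanEntropy
import Literature.Geometry.Riemannian.CanonicalNeighbourhoodsProofs
import Literature.Geometry.Riemannian.RicciFlowScalarCurvatureProofs
import HarnessLib

/-!
# No local collapsing from three entropy estimates (Topping 2006, §8.3, Thm. 8.3.4 ⇒ 8.3.1)

`CanonicalNeighbourhoodsProofs.lean` reduces Perelman's no local collapsing theorem I, in the
vended form `perelman_noLocalCollapsing` (`CanonicalNeighbourhoods.lean`), to the **entropy
dichotomy bound** (`perelman_noLocalCollapsing_of_entropyDichotomy`). With the vocabulary
`𝒲, μ` of `PerelmanEntropy.lean` we push the reduction one step further, to the three classical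
entropy estimates of Topping's Chapter 8 — each a separate published statement, taken here as
an explicit hypothesis (none is proved in the tree; no named fact is introduced):

* **(T1) test-function upper bound** — Topping 2006, Lemma 8.3.5: for a smooth metric `g` on a
  closed manifold, `r > 0`, `p`, `λ > 0`,
  `μ(g, λr²) ≤ 36λ (𝒱(p,r) - 𝒱(p,r/2))/𝒱(p,r/2) + (λr²/𝒱(p,r/2)) ∫_{B(p,r)} |R| dV
   + ln [𝒱(p,r)/(4πλr²)^{n/2}] - n`;
* **(T2) monotonicity of `μ`** — Topping 2006, (8.3.10) (from Prop. 8.2.1, the entropy formula,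
  and Remark 8.2.5, backward solvability of the conjugate heat equation; Perelman 2002, (3.4)):
  along a Ricci flow on a closed manifold on `[0, T']`, `μ(g(0), τ + T') ≤ μ(g(T'), τ)`;
* **(T3) `μ` is bounded below on bounded scales** — Topping 2006, Lemma 8.1.8 (second part;
  Perelman 2002, §3.1): `inf_{τ ∈ (0, τ₀]} μ(g, τ) > -∞` on a closed manifold.

Main results (all proved):

* `abs_scalarCurvatureWith_le_of_curvatureBoundedOn` — a frame-wise curvature bound
  `|Rm| ≤ C` (`CurvatureBoundedOn`) gives `|R| ≤ n² C` (O'Neill 1983, Def. 3.53: `R = Σᵢⱼ Rm`);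
* `mul_pow_le_of_entropy_estimate` — the real-variable heart of Topping's proof of Thm. 8.3.4 /
  (8.3.11): from (T1) at `λ = 1/36`, a lower bound `m ≤ μ`, `∫_B |R| ≤ n² s⁻² 𝒱(s)` and the
  doubling property `𝒱(s) ≤ 2ⁿ⁺¹ 𝒱(s/2)` one gets `ξ sⁿ ≤ 𝒱(s)` with
  `ξ = (π/9)^{n/2} exp (m + n - (1 + n²) 2ⁿ⁺¹)`;
* `entropyDichotomy_of_muBounds` — for one Ricci flow on `[0, T)` on a closed manifold, (T1)–(T3)
  for its slices give the entropy dichotomy bound with a `ξ > 0` independent of `(t₀, p, s)`;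
* `perelman_noLocalCollapsing_of_muBounds` — **(T1) ∧ (T2) ∧ (T3) ⇒ `perelman_noLocalCollapsing`**.

So the named fact is now conditional exactly on the `𝒲`-entropy analysis (T1)–(T3); the
geometric-measure-theoretic half (small balls, halving iteration, curvature bookkeeping) is
unconditional.

## References

* P. Topping, *Lectures on the Ricci flow*, LMS Lecture Note Series 325, CUP 2006, §8.1
  (Lemma 8.1.8), §8.2 (Prop. 8.2.1, Rem. 8.2.5), §8.3 (Thm. 8.3.1, Rem. 8.3.2, Thm. 8.3.4,
  Lemma 8.3.5, (8.3.8)–(8.3.11)). [Topping2006]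
* G. Perelman, *The entropy formula for the Ricci flow and its geometric applications*,
  arXiv:math/0211159 (2002), §3.1, §4. [Perelman2002]
* B. O'Neill, *Semi-Riemannian geometry*, Academic Press 1983, Ch. 3, Def. 3.53. [ONeill1983]
-/

noncomputable section

open Bundle Set Module Filter MeasureTheory Manifold
open scoped ContDiff Topology ENNReal NNReal

namespace Literature.Geometry.Riemannian

open Lorentzian

universe u v w

variable {E : Type*} [NormedAddCommGroup E] [NormedSpace ℝ E] [FiniteDimensional ℝ E]
  {H : Type*} [TopologicalSpace H] {I : ModelWithCorners ℝ E H} {M : Type*} [TopologicalSpace M]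
  [ChartedSpace H M] [IsManifold I ∞ M] [T3Space M] [MeasurableSpace M] [BorelSpace M]

/-! ### Frame-wise curvature bounds bound the scalar curvature -/

omit [T3Space M] [MeasurableSpace M] [BorelSpace M] in
/-- **`|R| ≤ n² C` from `|Rm| ≤ C`.** If `g` is Riemannian and the curvature of `(g, cov)` is
bounded by `C` on `U` in the frame-wise sense `CurvatureBoundedOn` (`|Rm(X,Y,Z,W)| ≤ C` for
`g`-unit vectors), then `|R(x)| ≤ n² C` at every `x ∈ U`, `n = dim M`: write
`R = Σᵢ Σⱼ Rm(bⱼ, bᵢ, bᵢ, bⱼ)` in a `g_x`-orthonormal basis (O'Neill 1983, Ch. 3, Def. 3.53) and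
bound each of the `n²` terms by `C`. [cite: ONeill1983, Ch. 3, Def. 3.53] -/
theorem abs_scalarCurvatureWith_le_of_curvatureBoundedOn {n' : ℕ∞ω}
    {g : PseudoRiemannianMetric I n' E (TangentSpace I : M → Type _)} (hg : g.IsRiemannian)
    {cov : CovariantDerivative I E (TangentSpace I : M → Type _)} {U : Set M} {C : ℝ}
    (h : CurvatureBoundedOn g cov U C) {x : M} (hx : x ∈ U) :
    |g.scalarCurvatureWith cov x| ≤ (finrank ℝ E : ℝ) ^ 2 * C := by
  obtain ⟨b, hb⟩ := g.exists_basis_isOrthonormalFrame (x := x) (fun v hv ↦ hg x v hv) rfl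
  rw [g.scalarCurvatureWith_eq_sum_of_isOrthonormalFrame b hb cov]
  have hle : ∀ i j, |g.curvatureForm cov x (b j) (b i) (b i) (b j)| ≤ C := fun i j ↦
    h x hx (b j) (b i) (b i) (b j) (hb.1 j).le (hb.1 i).le (hb.1 i).le (hb.1 j).le
  calc |∑ i, ∑ j, g.curvatureForm cov x (b j) (b i) (b i) (b j)|
      ≤ ∑ i, |∑ j, g.curvatureForm cov x (b j) (b i) (b i) (b j)| := Finset.abs_sum_le_sum_abs _ _
    _ ≤ ∑ i, ∑ j, |g.curvatureForm cov x (b j) (b i) (b i) (b j)| :=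
        Finset.sum_le_sum fun i _ ↦ Finset.abs_sum_le_sum_abs _ _
    _ ≤ ∑ _i : Fin (finrank ℝ E), ∑ _j : Fin (finrank ℝ E), C :=
        Finset.sum_le_sum fun i _ ↦ Finset.sum_le_sum fun j _ ↦ hle i j
    _ = (finrank ℝ E : ℝ) ^ 2 * C := by
        simp only [Finset.sum_const, Finset.card_univ, Fintype.card_fin]
        ring

/-- **`∫_{B(p,s)} |R| dV ≤ n² C · Vol B(p,s)`** under a frame-wise curvature bound `C` on the
ball, for a Riemannian `g` whose ball has finite volume. [folklore] -/
theorem setIntegral_abs_scalarCurvatureWith_le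
    {g : PseudoRiemannianMetric I ∞ E (TangentSpace I : M → Type _)} (hg : g.IsRiemannian)
    {cov : CovariantDerivative I E (TangentSpace I : M → Type _)} {p : M} {r : ℝ≥0∞} {C : ℝ}
    (h : CurvatureBoundedOn g cov (g.ball p r) C) (hfin : g.vol (g.ball p r) < ⊤) :
    ∫ x in g.ball p r, |g.scalarCurvatureWith cov x| ∂g.riemVolume ≤
      (finrank ℝ E : ℝ) ^ 2 * C * (g.vol (g.ball p r)).toReal := by
  have hb := norm_setIntegral_le_of_norm_le_const (μ := g.riemVolume) (s := g.ball p r)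
    (f := fun x ↦ |g.scalarCurvatureWith cov x|) (C := (finrank ℝ E : ℝ) ^ 2 * C) hfin
    (fun x hx ↦ by
      rw [Real.norm_eq_abs, abs_abs]
      exact abs_scalarCurvatureWith_le_of_curvatureBoundedOn hg h hx)
  exact (le_abs_self _).trans (by simpa [Real.norm_eq_abs, measureReal_def] using hb)

/-! ### The real-variable core of Topping's Thm. 8.3.4 ⇒ (8.3.11) ⇒ non-collapsing -/

/-- **From the entropy estimate to a volume-ratio bound** (the arithmetic of Topping 2006,
(8.3.8)–(8.3.11) and of Case "`𝒦 ≤ ξ`" in the proof of Thm. 8.3.1, with the doubling constant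
`2ⁿ⁺¹`). Let `V₁ = 𝒱(p,s) ≥ V₂ = 𝒱(p,s/2) > 0`, `J = ∫_{B(p,s)} |R| dV`, and suppose
* the test-function bound at `λ = 1/36`:
  `m ≤ 36·(1/36)·(V₁ - V₂)/V₂ + (1/36)·s²/V₂ · J + log [V₁ / (4π·(1/36)·s²)^{n/2}] - n`
  (Lemma 8.3.5 combined with a lower bound `m ≤ μ(g, s²/36)`),
* the curvature bound `J ≤ n² s⁻² V₁` and the doubling property `V₁ ≤ 2ⁿ⁺¹ V₂`.
Then `ξ sⁿ ≤ V₁` with `ξ = (π/9)^{n/2} exp (m + n - (1 + n²) 2ⁿ⁺¹)`. [cite: Topping2006, §8.3, (8.3.11) and proof of Thm. 8.3.1] -/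
theorem mul_pow_le_of_entropy_estimate (n : ℕ) {m V₁ V₂ s J : ℝ} (hs : 0 < s) (hV₂ : 0 < V₂)
    (hV : V₂ ≤ V₁)
    (hent : m ≤ 36 * (1 / 36) * (V₁ - V₂) / V₂ + 1 / 36 * s ^ 2 / V₂ * J +
      Real.log (V₁ / (4 * Real.pi * (1 / 36) * s ^ 2) ^ ((n : ℝ) / 2)) - n)
    (hJ : J ≤ (n : ℝ) ^ 2 * (s⁻¹ ^ 2) * V₁) (hdoub : V₁ ≤ 2 ^ (n + 1) * V₂) :
    (Real.pi / 9) ^ ((n : ℝ) / 2) * Real.exp (m + n - (1 + (n : ℝ) ^ 2) * 2 ^ (n + 1)) * s ^ n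
      ≤ V₁ := by
  have hV₁ : 0 < V₁ := hV₂.trans_le hV
  have hπ : 0 < Real.pi / 9 := by positivity
  -- the scale factor `(4π s²/36)^{n/2} = (π/9)^{n/2} sⁿ`
  have hD : (4 * Real.pi * (1 / 36) * s ^ 2) ^ ((n : ℝ) / 2) = (Real.pi / 9) ^ ((n : ℝ) / 2) * s ^ n := by
    have h1 : 4 * Real.pi * (1 / 36) * s ^ 2 = (Real.pi / 9) * s ^ 2 := by ring
    rw [h1, Real.mul_rpow hπ.le (sq_nonneg s)]
    congr 1
    rw [show ((s ^ 2 : ℝ)) = s ^ (2 : ℝ) by norm_cast, ← Real.rpow_mul hs.le,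
      show (2 : ℝ) * ((n : ℝ) / 2) = n by ring, Real.rpow_natCast]
  have hDpos : 0 < (Real.pi / 9) ^ ((n : ℝ) / 2) * s ^ n := by positivity
  -- bound the two ratio terms by `2ⁿ⁺¹` and `n² 2ⁿ⁺¹`
  have hratio : V₁ / V₂ ≤ 2 ^ (n + 1) := by rwa [div_le_iff₀ hV₂]
  have hT1 : 36 * (1 / 36) * (V₁ - V₂) / V₂ ≤ 2 ^ (n + 1) := by
    calc 36 * (1 / 36) * (V₁ - V₂) / V₂ = (V₁ - V₂) / V₂ := by ring
      _ ≤ V₁ / V₂ := by gcongr; linarith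
      _ ≤ 2 ^ (n + 1) := hratio
  have hT2 : 1 / 36 * s ^ 2 / V₂ * J ≤ (n : ℝ) ^ 2 * 2 ^ (n + 1) := by
    have hcoef : 0 ≤ 1 / 36 * s ^ 2 / V₂ := by positivity
    calc 1 / 36 * s ^ 2 / V₂ * J ≤ 1 / 36 * s ^ 2 / V₂ * ((n : ℝ) ^ 2 * (s⁻¹ ^ 2) * V₁) := by
          gcongr
      _ = 1 / 36 * ((n : ℝ) ^ 2 * (V₁ / V₂)) := by field_simp
      _ ≤ 1 * ((n : ℝ) ^ 2 * 2 ^ (n + 1)) := by gcongr; norm_num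
      _ = (n : ℝ) ^ 2 * 2 ^ (n + 1) := one_mul _
  -- hence a lower bound for the logarithm of the volume ratio
  have hlog : m + n - (1 + (n : ℝ) ^ 2) * 2 ^ (n + 1) ≤
      Real.log (V₁ / ((Real.pi / 9) ^ ((n : ℝ) / 2) * s ^ n)) := by
    rw [← hD]; linarith
  have hexp := Real.exp_le_exp.2 hlog
  rw [Real.exp_log (div_pos hV₁ hDpos), le_div_iff₀ hDpos] at hexp
  calc (Real.pi / 9) ^ ((n : ℝ) / 2) * Real.exp (m + n - (1 + (n : ℝ) ^ 2) * 2 ^ (n + 1)) * s ^ n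
      = Real.exp (m + n - (1 + (n : ℝ) ^ 2) * 2 ^ (n + 1)) * ((Real.pi / 9) ^ ((n : ℝ) / 2) * s ^ n) := by
        ring
    _ ≤ V₁ := hexp

/-! ### One flow: (T1)–(T3) for its slices give the entropy dichotomy bound -/

section OneFlow

variable [I.Boundaryless] [CompactSpace M]
  {g : ℝ → PseudoRiemannianMetric I ∞ E (TangentSpace I : M → Type _)}
  {cov : ℝ → CovariantDerivative I E (TangentSpace I : M → Type _)} {T : ℝ}

/-- Geodesic balls of positive radius of a Riemannian metric have positive volume (they are open,
`isOpen_ball`, and contain their centre; `riemannianVolume_pos_of_isOpen`). [folklore] -/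
theorem _root_.Literature.Geometry.Lorentzian.PseudoRiemannianMetric.vol_ball_pos
    {G : PseudoRiemannianMetric I ∞ E (TangentSpace I : M → Type _)} (hG : G.IsRiemannian) (p : M)
    {r : ℝ≥0∞} (hr : 0 < r) : 0 < G.vol (G.ball p r) := by
  rw [PseudoRiemannianMetric.vol, PseudoRiemannianMetric.riemVolume_eq hG]
  exact riemannianVolume_pos_of_isOpen (G.toContMDiffRiemannianMetric hG)
    (PseudoRiemannianMetric.isOpen_ball hG p r) ⟨p, PseudoRiemannianMetric.mem_ball_self p hr⟩

omit [I.Boundaryless] in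
/-- On a compact manifold every geodesic ball has finite volume. [folklore] -/
theorem _root_.Literature.Geometry.Lorentzian.PseudoRiemannianMetric.vol_ball_lt_top
    (G : PseudoRiemannianMetric I ∞ E (TangentSpace I : M → Type _)) (p : M) (r : ℝ≥0∞) :
    G.vol (G.ball p r) < ⊤ :=
  (measure_mono (subset_univ _)).trans_lt G.riemVolume_univ_lt_top

/-- **The entropy dichotomy bound for one flow from (T1)–(T3) for its slices** (Topping 2006,
proof of Thm. 8.3.4 and (8.3.11), with Rem. 8.3.2 for the constant `C = n²` coming from the
frame-wise hypothesis `|Rm| ≤ s⁻²`). For a family `(g, cov)` of Riemannian metrics and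
connections on `[0, T)`, `0 < T`, on a closed manifold (in the application a Ricci flow with its
Levi-Civita connections), assume: (T1) Lemma 8.3.5 for every slice `g(t)`;
(T2) `μ(g(0), τ + t₀) ≤ μ(g(t₀), τ)` for `0 < t₀ < T`, `τ > 0`; (T3) `μ(g(0), ·)` is bounded
below on `(0, τ₀]` for every `τ₀ > 0`. Then there is `ξ > 0` such that for all `t₀ ∈ [0, T)`,
`p`, `0 < s < √T`: if the curvature of `g(t₀)` is bounded by `s⁻²` on `B_{t₀}(p, s)` and
`Vol B(p,s) ≤ 2ⁿ⁺¹ Vol B(p,s/2)`, then `ξ sⁿ ≤ Vol B(p, s)`.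
[cite: Topping2006, §8.3, Thm. 8.3.4 and (8.3.11)] -/
theorem entropyDichotomy_of_muBounds (hT : 0 < T) (hRiem : ∀ t ∈ Ico 0 T, (g t).IsRiemannian)
    (h₁ : ∀ t ∈ Ico 0 T, ∀ (p : M) (r lam : ℝ), 0 < r → 0 < lam →
      (g t).muEntropy (cov t) (lam * r ^ 2) ≤
        ((36 * lam * ((((g t).vol ((g t).ball p (ENNReal.ofReal r))).toReal -
              ((g t).vol ((g t).ball p (ENNReal.ofReal (r / 2)))).toReal)) /
              ((g t).vol ((g t).ball p (ENNReal.ofReal (r / 2)))).toReal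
          + lam * r ^ 2 / ((g t).vol ((g t).ball p (ENNReal.ofReal (r / 2)))).toReal *
              ∫ x in (g t).ball p (ENNReal.ofReal r), |(g t).scalarCurvatureWith (cov t) x|
                ∂(g t).riemVolume
          + Real.log (((g t).vol ((g t).ball p (ENNReal.ofReal r))).toReal /
              (4 * Real.pi * lam * r ^ 2) ^ ((finrank ℝ E : ℝ) / 2))
          - finrank ℝ E : ℝ) : EReal))
    (h₂ : ∀ t₀ ∈ Ioo 0 T, ∀ τ : ℝ, 0 < τ →
      (g 0).muEntropy (cov 0) (τ + t₀) ≤ (g t₀).muEntropy (cov t₀) τ)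
    (h₃ : ∀ τ₀ : ℝ, 0 < τ₀ → ∃ m : ℝ, ∀ τ ∈ Ioc 0 τ₀, (m : EReal) ≤ (g 0).muEntropy (cov 0) τ) :
    ∃ ξ : ℝ, 0 < ξ ∧ ∀ t₀ ∈ Ico 0 T, ∀ (p : M) (s : ℝ), 0 < s → s < Real.sqrt T →
      CurvatureBoundedOn (g t₀) (cov t₀) ((g t₀).ball p (ENNReal.ofReal s)) (s⁻¹ ^ 2) →
      (g t₀).vol ((g t₀).ball p (ENNReal.ofReal s)) ≤
        2 ^ (finrank ℝ E + 1) * (g t₀).vol ((g t₀).ball p (ENNReal.ofReal (s / 2))) →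
      ENNReal.ofReal (ξ * s ^ finrank ℝ E) ≤ (g t₀).vol ((g t₀).ball p (ENNReal.ofReal s)) := by
  set n := finrank ℝ E with hn
  -- (T3): a uniform lower bound `m` for `μ(g(0), τ)`, `τ ∈ (0, T/36 + T]`
  obtain ⟨m, hm⟩ := h₃ (T / 36 + T) (by positivity)
  refine ⟨(Real.pi / 9) ^ ((n : ℝ) / 2) * Real.exp (m + n - (1 + (n : ℝ) ^ 2) * 2 ^ (n + 1)),
    by positivity, fun t₀ ht₀ p s hs hsT hcurv hdoub ↦ ?_⟩
  have hG : (g t₀).IsRiemannian := hRiem t₀ ht₀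
  have hs2 : s ^ 2 < T := by
    calc s ^ 2 < Real.sqrt T ^ 2 := by gcongr
      _ = T := Real.sq_sqrt hT.le
  -- Step 1: `m ≤ μ(g(t₀), s²/36)` by (T3) at `t₀ = 0` and (T2)+(T3) for `t₀ > 0`
  have hμ : (m : EReal) ≤ (g t₀).muEntropy (cov t₀) (1 / 36 * s ^ 2) := by
    rcases ht₀.1.eq_or_lt with h0 | h0
    · subst h0
      exact hm _ ⟨by positivity, by linarith⟩
    · calc (m : EReal) ≤ (g 0).muEntropy (cov 0) (1 / 36 * s ^ 2 + t₀) :=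
            hm _ ⟨by positivity, by linarith [ht₀.2]⟩
        _ ≤ (g t₀).muEntropy (cov t₀) (1 / 36 * s ^ 2) := h₂ t₀ ⟨h0, ht₀.2⟩ _ (by positivity)
  -- Step 2: (T1) at `λ = 1/36`, `r = s`, combined with Step 1, in `ℝ`
  have h₁' := h₁ t₀ ht₀ p s (1 / 36) hs (by norm_num)
  have hreal := EReal.coe_le_coe_iff.1 (hμ.trans h₁')
  -- the volumes as real numbers
  set V₁ := ((g t₀).vol ((g t₀).ball p (ENNReal.ofReal s))).toReal with hV₁
  set V₂ := ((g t₀).vol ((g t₀).ball p (ENNReal.ofReal (s / 2)))).toReal with hV₂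
  have hfin₁ := (g t₀).vol_ball_lt_top p (ENNReal.ofReal s)
  have hfin₂ := (g t₀).vol_ball_lt_top p (ENNReal.ofReal (s / 2))
  have hV₂pos : 0 < V₂ := ENNReal.toReal_pos
    (PseudoRiemannianMetric.vol_ball_pos hG p (ENNReal.ofReal_pos.2 (half_pos hs))).ne' hfin₂.ne
  have hV : V₂ ≤ V₁ := ENNReal.toReal_mono hfin₁.ne
    ((g t₀).vol_mono ((g t₀).ball_mono p (ENNReal.ofReal_le_ofReal (by linarith))))
  -- the curvature integral and the doubling property in `ℝ`
  have hJ : ∫ x in (g t₀).ball p (ENNReal.ofReal s), |(g t₀).scalarCurvatureWith (cov t₀) x|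
      ∂(g t₀).riemVolume ≤ (n : ℝ) ^ 2 * (s⁻¹ ^ 2) * V₁ :=
    setIntegral_abs_scalarCurvatureWith_le hG hcurv hfin₁
  have hdoub' : V₁ ≤ 2 ^ (n + 1) * V₂ := by
    have := ENNReal.toReal_mono (ENNReal.mul_ne_top (by simp) hfin₂.ne) hdoub
    simpa [hV₁, hV₂, ENNReal.toReal_mul, ENNReal.toReal_pow] using this
  -- Step 3: the real-variable lemma, and back to `ℝ≥0∞`
  have hkey := mul_pow_le_of_entropy_estimate n hs hV₂pos hV (by simpa [mul_comm] using hreal)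
    hJ hdoub'
  exact ENNReal.ofReal_le_of_le_toReal hkey

end OneFlow

/-! ### (T1) ∧ (T2) ∧ (T3) ⇒ `perelman_noLocalCollapsing` -/

/-- **Perelman's no local collapsing theorem I from the three entropy estimates** (Topping 2006,
§8.3: Lemma 8.3.5 + (8.3.10) + Lemma 8.1.8 ⇒ Thm. 8.3.4 ⇒ Thm. 8.3.1; then the vended parabolic
`κ`-form via `perelman_noLocalCollapsing_of_entropyDichotomy`). The hypotheses, each over all
closed manifolds (compact, Hausdorff, second countable, boundaryless, any Borel structure):
* `h₁` (**Topping Lemma 8.3.5**): for `g` Riemannian with Levi-Civita connection `cov`, `p`,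
  `r > 0`, `λ > 0`: `μ(g, λr²) ≤ 36λ (𝒱(p,r) - 𝒱(p,r/2))/𝒱(p,r/2)
  + (λr²/𝒱(p,r/2)) ∫_{B(p,r)} |R| dV + log [𝒱(p,r)/(4πλr²)^{n/2}] - n`
  (volumes as real numbers, `𝒱 = (Vol ·).toReal`);
* `h₂` (**Topping (8.3.10)**, from Prop. 8.2.1 and Rem. 8.2.5; Perelman 2002, (3.4)): for a
  Ricci flow of Riemannian metrics on `[0, T']`, `T' > 0`, and `τ > 0`:
  `μ(g(0), τ + T') ≤ μ(g(T'), τ)`;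
* `h₃` (**Topping Lemma 8.1.8**, boundedness; Perelman 2002, §3.1): for `g` Riemannian with
  Levi-Civita `cov` and `τ₀ > 0` there is `m` with `m ≤ μ(g, τ)` for all `τ ∈ (0, τ₀]`.
Conclusion: `perelman_noLocalCollapsing`. This is NOT a discharge of the named fact — it makes
the fact conditional precisely on the `𝒲`-entropy analysis (T1)–(T3).
[cite: Topping2006, §8.3, Thm. 8.3.1, Thm. 8.3.4, Lemma 8.3.5] -/
theorem perelman_noLocalCollapsing_of_muBounds
    (h₁ : ∀ {E : Type u} [NormedAddCommGroup E] [NormedSpace ℝ E] [FiniteDimensional ℝ E]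
      {H : Type v} [TopologicalSpace H] (I : ModelWithCorners ℝ E H) [I.Boundaryless]
      (M : Type w) [TopologicalSpace M] [T2Space M] [SecondCountableTopology M] [CompactSpace M]
      [ChartedSpace H M] [IsManifold I ∞ M] [MeasurableSpace M] [BorelSpace M]
      (g : PseudoRiemannianMetric I ∞ E (TangentSpace I : M → Type _))
      (cov : CovariantDerivative I E (TangentSpace I : M → Type _)),
      g.IsRiemannian → g.IsLeviCivita cov → ∀ (p : M) (r lam : ℝ), 0 < r → 0 < lam →
        g.muEntropy cov (lam * r ^ 2) ≤
          ((36 * lam * (((g.vol (g.ball p (ENNReal.ofReal r))).toReal -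
                (g.vol (g.ball p (ENNReal.ofReal (r / 2)))).toReal)) /
                (g.vol (g.ball p (ENNReal.ofReal (r / 2)))).toReal
            + lam * r ^ 2 / (g.vol (g.ball p (ENNReal.ofReal (r / 2)))).toReal *
                ∫ x in g.ball p (ENNReal.ofReal r), |g.scalarCurvatureWith cov x| ∂g.riemVolume
            + Real.log ((g.vol (g.ball p (ENNReal.ofReal r))).toReal /
                (4 * Real.pi * lam * r ^ 2) ^ ((finrank ℝ E : ℝ) / 2))
            - finrank ℝ E : ℝ) : EReal))
    (h₂ : ∀ {E : Type u} [NormedAddCommGroup E] [NormedSpace ℝ E] [FiniteDimensional ℝ E]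
      {H : Type v} [TopologicalSpace H] (I : ModelWithCorners ℝ E H) [I.Boundaryless]
      (M : Type w) [TopologicalSpace M] [T2Space M] [SecondCountableTopology M] [CompactSpace M]
      [ChartedSpace H M] [IsManifold I ∞ M] [MeasurableSpace M] [BorelSpace M] (T' : ℝ), 0 < T' →
      ∀ (g : ℝ → PseudoRiemannianMetric I ∞ E (TangentSpace I : M → Type _))
        (cov : ℝ → CovariantDerivative I E (TangentSpace I : M → Type _)),
        IsRicciFlow g cov (Icc 0 T') → (∀ t ∈ Icc 0 T', (g t).IsRiemannian) →
          ∀ τ : ℝ, 0 < τ → (g 0).muEntropy (cov 0) (τ + T') ≤ (g T').muEntropy (cov T') τ)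
    (h₃ : ∀ {E : Type u} [NormedAddCommGroup E] [NormedSpace ℝ E] [FiniteDimensional ℝ E]
      {H : Type v} [TopologicalSpace H] (I : ModelWithCorners ℝ E H) [I.Boundaryless]
      (M : Type w) [TopologicalSpace M] [T2Space M] [SecondCountableTopology M] [CompactSpace M]
      [ChartedSpace H M] [IsManifold I ∞ M] [MeasurableSpace M] [BorelSpace M]
      (g : PseudoRiemannianMetric I ∞ E (TangentSpace I : M → Type _))
      (cov : CovariantDerivative I E (TangentSpace I : M → Type _)),
      g.IsRiemannian → g.IsLeviCivita cov → ∀ τ₀ : ℝ, 0 < τ₀ →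
        ∃ m : ℝ, ∀ τ ∈ Ioc 0 τ₀, (m : EReal) ≤ g.muEntropy cov τ) :
    perelman_noLocalCollapsing.{u, v, w} := by
  refine perelman_noLocalCollapsing_of_entropyDichotomy ?_
  intro E _ _ _ H _ I _ M _ _ _ _ _ _ _ _ T hT g cov hflow hRiem
  refine entropyDichotomy_of_muBounds hT hRiem ?_ ?_ ?_
  · intro t ht p r lam hr hlam
    exact h₁ I M (g t) (cov t) (hRiem t ht) (hflow.isLeviCivita t ht) p r lam hr hlam
  · intro t₀ ht₀ τ hτ
    have hsub : Icc 0 t₀ ⊆ Ico 0 T := fun t ht ↦ ⟨ht.1, ht.2.trans_lt ht₀.2⟩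
    exact h₂ I M t₀ ht₀.1 g cov (hflow.mono hsub) (fun t ht ↦ hRiem t (hsub ht)) τ hτ
  · have h0 : (0 : ℝ) ∈ Ico 0 T := ⟨le_rfl, hT⟩
    exact h₃ I M (g 0) (cov 0) (hRiem 0 h0) (hflow.isLeviCivita 0 h0)

end Literature.Geometry.Riemannian

end
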